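import Mathlib
import HarnessLib
import Literature.Analysis.ValidatedNumerics.IntervalTotalStepIteration
import Literature.Analysis.ValidatedNumerics.IntervalSchulzIteration

/-!
# The inverse-inclusion iteration with a varying interval matrix (Alefeld–Herzberger, Ch. 20, Theorem 1)

Source: G. Alefeld, J. Herzberger, *Introduction to Interval Computations*, Academic Press 1983, Ch. 20
("Newton-like methods without matrix inversions"), pp. 255–257: the iteration (1), Theorem 1 with parts
(2a) and (2b) and its proof, and the two remarks following the proof (the method (18.9) with `r = 2` is the
special case `𝓐⁽ᵏ⁾ = 𝓐`; for a nested sequence `𝓐⁽ᵏ⁾ ⊇ 𝓐` all inverses `𝓐̃⁻¹`, `𝓐̃ ∈ 𝓐`, stay included).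

Setting.  `𝓐` is a nonsingular `n × n` matrix and `{𝓐⁽ᵏ⁾}` a sequence of interval matrices with
`𝓐 ∈ 𝓐⁽ᵏ⁾` and `lim 𝓐⁽ᵏ⁾ = 𝓐`.  With an interval matrix `𝓦⁽⁰⁾ ∋ 𝓐⁻¹` the iteration

  (1) `𝓦⁽ᵏ⁺¹⁾ = {m(𝓦⁽ᵏ⁾) + 𝓦⁽ᵏ⁾(𝓘 − 𝓐⁽ᵏ⁾m(𝓦⁽ᵏ⁾))} ∩ 𝓦⁽ᵏ⁾`, `k ≥ 0`,

is formed (here `𝓦⁽ᵏ⁾(𝓘 − 𝓐⁽ᵏ⁾m(𝓦⁽ᵏ⁾))` is a product of two interval matrices).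

**Theorem 1.** (2a) Every iterate `𝓦⁽ᵏ⁾` exists and contains `𝓐⁻¹`.  (2b) If every matrix `𝓦 ∈ 𝓦⁽⁰⁾` is
nonsingular, then `lim 𝓦⁽ᵏ⁾ = 𝓐⁻¹`.

Proof as in the book.  (a): `𝓐⁻¹ = m(𝓦) + 𝓐⁻¹(𝓘 − 𝓐m(𝓦))` and inclusion monotonicity.  (b): the iterates
are nested, so by Cor. 10.8 they converge to an interval matrix `𝓦`; continuity of (1) gives
`𝓦 = {m(𝓦) + 𝓦(𝓘 − 𝓐m(𝓦))} ∩ 𝓦`, hence `m(𝓦) ∈ m(𝓦) + 𝓦(𝓘 − 𝓐m(𝓦))`; by (10.1) there are matrices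
`𝓦⁽ʲ⁾ ∈ 𝓦` with `𝓦⁽ʲ⁾(𝓘 − 𝓐m(𝓦))_j = 0` for every column `j`; as `𝓦⁽ʲ⁾ ∈ 𝓦⁽⁰⁾` is nonsingular,
`(𝓘 − 𝓐m(𝓦))_j = 0`, so `m(𝓦) = 𝓐⁻¹` and then `𝓦 = 𝓐⁻¹`.

The interval matrices are carried, as in `IntervalSchulzIteration` (Ch. 18), as pairs `(W̲, W̄)` of bound
matrices (`IMat ι`, `Mem`, `mid`, `mulPoint`, `addPoint`, `schulzStep`, `interStep`, `TendstoI` are reused from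
there); this file adds the interval-matrix product `imul` (with the scalar products `pmulLo`/`pmulHi` of
`IntervalTotalStepIteration`), the iteration (1) as `seqW`, Cor. 10.8 for interval matrices and the
representation (10.1) of the entries of `𝓦𝓒`.

Honest scope.  NOT formalised: the combined method (3) and Theorem 2 of Ch. 20 (quadratic convergence with a
Lipschitz Fréchet derivative), and the reference to (19.10).
-/

open Filter Topology

noncomputable section

namespace Literature.Analysis.ValidatedNumerics.InverseInclusionIteration

open Literature.Analysis.ValidatedNumerics.IntervalSchulzIteration
open Literature.Analysis.ValidatedNumerics.IntervalTotalStepIteration (pmulLo pmulHi pmulLo_le_mul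
  mul_le_pmulHi pmulLo_le_pmulHi)

variable {ι : Type*}

/-! ## §1 Degenerate interval matrices, `𝓒 − 𝓧`, inclusion -/

/-- A point matrix `𝓒` regarded as the degenerate interval matrix `[𝓒, 𝓒]`.
[cite: AlefeldHerzberger1983, Ch. 10] -/
def thin (C : Matrix ι ι ℝ) : IMat ι := (C, C)

/-- [cite: AlefeldHerzberger1983, Ch. 10] -/
@[simp] theorem thin_fst (C : Matrix ι ι ℝ) : (thin C).1 = C := rfl

/-- [cite: AlefeldHerzberger1983, Ch. 10] -/
@[simp] theorem thin_snd (C : Matrix ι ι ℝ) : (thin C).2 = C := rfl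

/-- `𝓟 ∈ [𝓒, 𝓒] ⇔ 𝓟 = 𝓒`. [cite: AlefeldHerzberger1983, Ch. 10] -/
theorem mem_thin_iff (P C : Matrix ι ι ℝ) : Mem P (thin C) ↔ P = C := by
  refine ⟨fun h => ?_, fun h i j => by rw [h]; exact ⟨le_rfl, le_rfl⟩⟩
  ext i j
  exact le_antisymm (h i j).2 (h i j).1

/-- [cite: AlefeldHerzberger1983, Ch. 10] -/
theorem mem_thin (C : Matrix ι ι ℝ) : Mem C (thin C) := (mem_thin_iff C C).2 rfl

/-- [cite: AlefeldHerzberger1983, Ch. 10] -/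
theorem isProper_thin (C : Matrix ι ι ℝ) : IsProper (thin C) := fun _ _ => le_rfl

/-- `𝓒 − 𝓧 = [𝓒 − X̄, 𝓒 − X̲]` for a point matrix `𝓒`. [cite: AlefeldHerzberger1983, Ch. 10 (matrix operations)] -/
def pointSub (C : Matrix ι ι ℝ) (X : IMat ι) : IMat ι := (C - X.2, C - X.1)

/-- [cite: AlefeldHerzberger1983, Ch. 10] -/
@[simp] theorem pointSub_fst (C : Matrix ι ι ℝ) (X : IMat ι) : (pointSub C X).1 = C - X.2 := rfl

/-- [cite: AlefeldHerzberger1983, Ch. 10] -/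
@[simp] theorem pointSub_snd (C : Matrix ι ι ℝ) (X : IMat ι) : (pointSub C X).2 = C - X.1 := rfl

/-- `𝓠 ∈ 𝓧 ⇒ 𝓒 − 𝓠 ∈ 𝓒 − 𝓧`. [cite: AlefeldHerzberger1983, Thm 10.5 (10')] -/
theorem sub_mem_pointSub {Q : Matrix ι ι ℝ} {X : IMat ι} (h : Mem Q X) (C : Matrix ι ι ℝ) :
    Mem (C - Q) (pointSub C X) := fun i j => by
  simp only [pointSub_fst, pointSub_snd, Matrix.sub_apply]
  exact ⟨sub_le_sub le_rfl (h i j).2, sub_le_sub le_rfl (h i j).1⟩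

/-- [cite: AlefeldHerzberger1983, Ch. 10] -/
theorem pointSub_thin (C D : Matrix ι ι ℝ) : pointSub C (thin D) = thin (C - D) := rfl

/-- `𝓧 ⊆ 𝓨` for interval matrices. [cite: AlefeldHerzberger1983, Ch. 10] -/
def Incl (X Y : IMat ι) : Prop := ∀ i j, Y.1 i j ≤ X.1 i j ∧ X.2 i j ≤ Y.2 i j

/-- [cite: AlefeldHerzberger1983, Ch. 10] -/
theorem incl_refl (X : IMat ι) : Incl X X := fun _ _ => ⟨le_rfl, le_rfl⟩

/-- [cite: AlefeldHerzberger1983, Ch. 10] -/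
theorem incl_trans {X Y Z : IMat ι} (h₁ : Incl X Y) (h₂ : Incl Y Z) : Incl X Z := fun i j =>
  ⟨(h₂ i j).1.trans (h₁ i j).1, (h₁ i j).2.trans (h₂ i j).2⟩

/-- `𝓟 ∈ 𝓧 ⇔ [𝓟, 𝓟] ⊆ 𝓧`. [cite: AlefeldHerzberger1983, Ch. 10] -/
theorem mem_iff_incl_thin (P : Matrix ι ι ℝ) (X : IMat ι) : Mem P X ↔ Incl (thin P) X := Iff.rfl

/-- [cite: AlefeldHerzberger1983, Ch. 10] -/
theorem mem_of_mem_of_incl {P : Matrix ι ι ℝ} {X Y : IMat ι} (h : Mem P X) (hXY : Incl X Y) : Mem P Y :=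
  fun i j => ⟨(hXY i j).1.trans (h i j).1, (h i j).2.trans (hXY i j).2⟩

/-! ## §2 Convergence of interval matrices ((10.26)) and Corollary 10.8 -/

/-- `lim 𝓧⁽ᵏ⁾ = 𝓛` for interval matrices: both bound sequences converge entrywise to the bounds of `𝓛`
((10.26)); `TendstoI 𝓧 𝓟` of Ch. 18 is the case `𝓛 = [𝓟, 𝓟]`. [cite: AlefeldHerzberger1983, Ch. 10 (10.26)] -/
def LimI (X : ℕ → IMat ι) (L : IMat ι) : Prop :=
  ∀ i j, Tendsto (fun k => (X k).1 i j) atTop (𝓝 (L.1 i j)) ∧ Tendsto (fun k => (X k).2 i j) atTop (𝓝 (L.2 i j))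

/-- [cite: AlefeldHerzberger1983, Ch. 10 (10.26)] -/
theorem tendstoI_iff_limI_thin (X : ℕ → IMat ι) (P : Matrix ι ι ℝ) : TendstoI X P ↔ LimI X (thin P) :=
  Iff.rfl

/-- (10.26) is convergence in the product topology of the bound matrices.
[cite: AlefeldHerzberger1983, Ch. 10 (10.26)] -/
theorem limI_iff_tendsto (X : ℕ → IMat ι) (L : IMat ι) : LimI X L ↔ Tendsto X atTop (𝓝 L) := by
  constructor
  · intro h
    exact (tendsto_pi_nhds.2 fun i => tendsto_pi_nhds.2 fun j => (h i j).1).prodMk_nhds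
      (tendsto_pi_nhds.2 fun i => tendsto_pi_nhds.2 fun j => (h i j).2)
  · intro h i j
    exact ⟨tendsto_pi_nhds.1 (tendsto_pi_nhds.1 ((continuous_fst.tendsto _).comp h) i) j,
      tendsto_pi_nhds.1 (tendsto_pi_nhds.1 ((continuous_snd.tendsto _).comp h) i) j⟩

/-- The limit (10.26) is unique. [cite: AlefeldHerzberger1983, Ch. 10 (10.26)] -/
theorem limI_unique {X : ℕ → IMat ι} {L L' : IMat ι} (h : LimI X L) (h' : LimI X L') : L = L' :=
  Prod.ext (Matrix.ext fun i j => tendsto_nhds_unique (h i j).1 (h' i j).1)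
    (Matrix.ext fun i j => tendsto_nhds_unique (h i j).2 (h' i j).2)

/-- **Corollary 10.8** for interval matrices: a nested sequence `𝓧⁽⁰⁾ ⊇ 𝓧⁽¹⁾ ⊇ ⋯` of interval matrices
converges to an interval matrix `𝓛` with `𝓛 ⊆ 𝓧⁽ᵏ⁾` for all `k`, and `𝓛` contains every common
sub-interval-matrix of the `𝓧⁽ᵏ⁾`. [cite: AlefeldHerzberger1983, Cor 10.8] -/
theorem cor10_8 {X : ℕ → IMat ι} (hnest : ∀ k, Incl (X (k + 1)) (X k)) (hp : ∀ k, IsProper (X k)) :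
    ∃ L : IMat ι, LimI X L ∧ IsProper L ∧ (∀ k, Incl L (X k)) ∧
      ∀ Z : IMat ι, IsProper Z → (∀ k, Incl Z (X k)) → Incl Z L := by
  have hlo : ∀ i j, Monotone fun k => (X k).1 i j := fun i j =>
    monotone_nat_of_le_succ fun k => (hnest k i j).1
  have hhi : ∀ i j, Antitone fun k => (X k).2 i j := fun i j =>
    antitone_nat_of_succ_le fun k => (hnest k i j).2
  have hlohi : ∀ i j k l, (X k).1 i j ≤ (X l).2 i j := fun i j k l =>
    ((hlo i j (Nat.le_max_left k l)).trans (hp _ i j)).trans (hhi i j (Nat.le_max_right k l))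
  have hbA : ∀ i j, BddAbove (Set.range fun k => (X k).1 i j) := fun i j =>
    ⟨(X 0).2 i j, by rintro _ ⟨k, rfl⟩; exact hlohi i j k 0⟩
  have hbB : ∀ i j, BddBelow (Set.range fun k => (X k).2 i j) := fun i j =>
    ⟨(X 0).1 i j, by rintro _ ⟨k, rfl⟩; exact hlohi i j 0 k⟩
  refine ⟨(Matrix.of fun i j => ⨆ k, (X k).1 i j, Matrix.of fun i j => ⨅ k, (X k).2 i j),
    fun i j => ?_, fun i j => ?_, fun k i j => ?_, fun Z hZ hZk i j => ?_⟩
  · simp only [Matrix.of_apply]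
    exact ⟨tendsto_atTop_ciSup (hlo i j) (hbA i j), tendsto_atTop_ciInf (hhi i j) (hbB i j)⟩
  · simp only [Matrix.of_apply]
    exact ciSup_le fun k => le_ciInf fun l => hlohi i j k l
  · simp only [Matrix.of_apply]
    exact ⟨le_ciSup (hbA i j) k, ciInf_le (hbB i j) k⟩
  · simp only [Matrix.of_apply]
    exact ⟨ciSup_le fun k => (hZk k i j).1, le_ciInf fun k => (hZk k i j).2⟩

variable [Fintype ι]

/-! ## §3 The product of two interval matrices -/

/-- The product `𝓧𝓨` of two interval matrices: `(𝓧𝓨)_ij = Σ_k X_ik Y_kj` with the interval product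
`[a, b][c, d] = [min{ac, ad, bc, bd}, max{ac, ad, bc, bd}]`.
[cite: AlefeldHerzberger1983, Ch. 10 (matrix operations), Ch. 1 Def 2] -/
def imul (X Y : IMat ι) : IMat ι :=
  (Matrix.of fun i j => ∑ k, pmulLo (X.1 i k) (X.2 i k) (Y.1 k j) (Y.2 k j),
   Matrix.of fun i j => ∑ k, pmulHi (X.1 i k) (X.2 i k) (Y.1 k j) (Y.2 k j))

/-- [cite: AlefeldHerzberger1983, Ch. 10] -/
@[simp] theorem imul_fst_apply (X Y : IMat ι) (i j : ι) :
    (imul X Y).1 i j = ∑ k, pmulLo (X.1 i k) (X.2 i k) (Y.1 k j) (Y.2 k j) := rfl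

/-- [cite: AlefeldHerzberger1983, Ch. 10] -/
@[simp] theorem imul_snd_apply (X Y : IMat ι) (i j : ι) :
    (imul X Y).2 i j = ∑ k, pmulHi (X.1 i k) (X.2 i k) (Y.1 k j) (Y.2 k j) := rfl

/-- `𝓧𝓨` is a genuine interval matrix. [cite: AlefeldHerzberger1983, Ch. 10] -/
theorem isProper_imul (X Y : IMat ι) : IsProper (imul X Y) := fun i j => by
  simp only [imul_fst_apply, imul_snd_apply]
  exact Finset.sum_le_sum fun k _ => pmulLo_le_pmulHi _ _ _ _

/-- **(10.10')** for the product of interval matrices: `𝓟 ∈ 𝓧, 𝓠 ∈ 𝓨 ⇒ 𝓟𝓠 ∈ 𝓧𝓨`.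
[cite: AlefeldHerzberger1983, Thm 10.5 (10.10')] -/
theorem mul_mem_imul {P Q : Matrix ι ι ℝ} {X Y : IMat ι} (hP : Mem P X) (hQ : Mem Q Y) :
    Mem (P * Q) (imul X Y) := fun i j => by
  simp only [imul_fst_apply, imul_snd_apply, Matrix.mul_apply]
  exact ⟨Finset.sum_le_sum fun k _ => pmulLo_le_mul (hP i k) (hQ k j),
    Finset.sum_le_sum fun k _ => mul_le_pmulHi (hP i k) (hQ k j)⟩

/-- With a degenerate second factor the product is `𝓧𝓒` of Ch. 18. [cite: AlefeldHerzberger1983, Ch. 10] -/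
theorem imul_thin (X : IMat ι) (C : Matrix ι ι ℝ) : imul X (thin C) = mulPoint X C := by
  refine Prod.ext ?_ ?_
  · ext i j
    simp only [imul_fst_apply, thin_fst, thin_snd, mulPoint_fst_apply, pmulLo, min_self]
  · ext i j
    simp only [imul_snd_apply, thin_fst, thin_snd, mulPoint_snd_apply, pmulHi, max_self]

/-- `[𝓒, 𝓒]𝓑 = [𝓒𝓑, 𝓒𝓑]`. [cite: AlefeldHerzberger1983, Ch. 10] -/
theorem mulPoint_thin (C B : Matrix ι ι ℝ) : mulPoint (thin C) B = thin (C * B) := by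
  refine Prod.ext ?_ ?_
  · ext i j
    simp only [mulPoint_fst_apply, thin_fst, thin_snd, min_self, Matrix.mul_apply]
  · ext i j
    simp only [mulPoint_snd_apply, thin_fst, thin_snd, max_self, Matrix.mul_apply]

/-- `𝓧𝓞 = 𝓞`. [cite: AlefeldHerzberger1983, Ch. 10] -/
theorem mulPoint_zero (X : IMat ι) : mulPoint X 0 = thin 0 := by
  refine Prod.ext ?_ ?_
  · ext i j
    simp only [mulPoint_fst_apply, Matrix.zero_apply, mul_zero, min_self, Finset.sum_const_zero, thin_fst]
  · ext i j
    simp only [mulPoint_snd_apply, Matrix.zero_apply, mul_zero, max_self, Finset.sum_const_zero, thin_snd]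

/-! ## §4 The representation (10.1) of an entry of `𝓦𝓒` -/

/-- [folklore] a convex combination of two points of `[lo, hi]` lies in `[lo, hi]`. -/
private theorem convex_comb_mem {lo hi a b s : ℝ} (ha : lo ≤ a ∧ a ≤ hi) (hb : lo ≤ b ∧ b ≤ hi) (hs0 : 0 ≤ s)
    (hs1 : s ≤ 1) : lo ≤ (1 - s) * a + s * b ∧ (1 - s) * a + s * b ≤ hi := by
  constructor <;> nlinarith [ha.1, ha.2, hb.1, hb.2]

/-- **(10.1)** for one entry of `𝓦𝓒` (`𝓦` an interval matrix, `𝓒` a point matrix): every number of the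
interval `(𝓦𝓒)_ij` is `Σ_k w_k c_kj` for a point row `w ∈ (W_ik)_k`; hence for a column `j` every element of
`𝓦𝓒_j` is `𝓦̃𝓒_j` with a matrix `𝓦̃ ∈ 𝓦`. [cite: AlefeldHerzberger1983, Ch. 10 (10.1)] -/
theorem exists_row_of_mem_mulPoint {W : IMat ι} (hW : IsProper W) (C : Matrix ι ι ℝ) (i j : ι) {t : ℝ}
    (ht : (mulPoint W C).1 i j ≤ t ∧ t ≤ (mulPoint W C).2 i j) :
    ∃ w : ι → ℝ, (∀ k, W.1 i k ≤ w k ∧ w k ≤ W.2 i k) ∧ ∑ k, w k * C k j = t := by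
  classical
  -- endpoints realising the minimal and the maximal term
  obtain ⟨wl, hwl, hwl'⟩ : ∃ wl : ι → ℝ, (∀ k, W.1 i k ≤ wl k ∧ wl k ≤ W.2 i k) ∧
      ∀ k, wl k * C k j = min (W.1 i k * C k j) (W.2 i k * C k j) := by
    refine ⟨fun k => if W.1 i k * C k j ≤ W.2 i k * C k j then W.1 i k else W.2 i k, fun k => ?_, fun k => ?_⟩
    · by_cases h : W.1 i k * C k j ≤ W.2 i k * C k j
      · simp only [h, if_true]; exact ⟨le_rfl, hW i k⟩
      · simp only [h, if_false]; exact ⟨hW i k, le_rfl⟩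
    · by_cases h : W.1 i k * C k j ≤ W.2 i k * C k j
      · simp only [h, if_true]; exact (min_eq_left h).symm
      · simp only [h, if_false]; exact (min_eq_right (le_of_not_ge h)).symm
  obtain ⟨wu, hwu, hwu'⟩ : ∃ wu : ι → ℝ, (∀ k, W.1 i k ≤ wu k ∧ wu k ≤ W.2 i k) ∧
      ∀ k, wu k * C k j = max (W.1 i k * C k j) (W.2 i k * C k j) := by
    refine ⟨fun k => if W.1 i k * C k j ≤ W.2 i k * C k j then W.2 i k else W.1 i k, fun k => ?_, fun k => ?_⟩
    · by_cases h : W.1 i k * C k j ≤ W.2 i k * C k j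
      · simp only [h, if_true]; exact ⟨hW i k, le_rfl⟩
      · simp only [h, if_false]; exact ⟨le_rfl, hW i k⟩
    · by_cases h : W.1 i k * C k j ≤ W.2 i k * C k j
      · simp only [h, if_true]; exact (max_eq_right h).symm
      · simp only [h, if_false]; exact (max_eq_left (le_of_not_ge h)).symm
  have hSl : ∑ k, wl k * C k j = (mulPoint W C).1 i j := by
    rw [mulPoint_fst_apply]; exact Finset.sum_congr rfl fun k _ => hwl' k
  have hSu : ∑ k, wu k * C k j = (mulPoint W C).2 i j := by
    rw [mulPoint_snd_apply]; exact Finset.sum_congr rfl fun k _ => hwu' k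
  -- the common interpolation parameter
  obtain ⟨s, hs0, hs1, hs⟩ : ∃ s : ℝ, 0 ≤ s ∧ s ≤ 1 ∧
      (1 - s) * (mulPoint W C).1 i j + s * (mulPoint W C).2 i j = t := by
    by_cases heq : (mulPoint W C).1 i j = (mulPoint W C).2 i j
    · refine ⟨0, le_rfl, zero_le_one, ?_⟩
      have : t = (mulPoint W C).1 i j := le_antisymm (heq ▸ ht.2) ht.1
      rw [this]; ring
    · have hlt : (mulPoint W C).1 i j < (mulPoint W C).2 i j := lt_of_le_of_ne (ht.1.trans ht.2) heq
      have hpos : 0 < (mulPoint W C).2 i j - (mulPoint W C).1 i j := sub_pos.2 hlt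
      refine ⟨(t - (mulPoint W C).1 i j) / ((mulPoint W C).2 i j - (mulPoint W C).1 i j),
        div_nonneg (sub_nonneg.2 ht.1) hpos.le, (div_le_one hpos).2 (sub_le_sub ht.2 le_rfl), ?_⟩
      field_simp
      ring
  refine ⟨fun k => (1 - s) * wl k + s * wu k, fun k => convex_comb_mem (hwl k) (hwu k) hs0 hs1, ?_⟩
  calc ∑ k, ((1 - s) * wl k + s * wu k) * C k j
      = (1 - s) * ∑ k, wl k * C k j + s * ∑ k, wu k * C k j := by
        rw [Finset.mul_sum, Finset.mul_sum, ← Finset.sum_add_distrib]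
        exact Finset.sum_congr rfl fun k _ => by ring
    _ = t := by rw [hSl, hSu, hs]

/-- Column form of (10.1): if `𝓞 ∈ 𝓦𝓒` in column `j`, there is `𝓦̃ ∈ 𝓦` with `𝓦̃𝓒_j = 0`.
[cite: AlefeldHerzberger1983, Ch. 10 (10.1); Ch. 20 Thm 1, proof of (b)] -/
theorem exists_mem_mulVec_col_eq_zero {W : IMat ι} (hW : IsProper W) (C : Matrix ι ι ℝ) (j : ι)
    (h0 : ∀ i, (mulPoint W C).1 i j ≤ 0 ∧ 0 ≤ (mulPoint W C).2 i j) :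
    ∃ P : Matrix ι ι ℝ, Mem P W ∧ P.mulVec (fun k => C k j) = 0 := by
  choose w hw hw0 using fun i => exists_row_of_mem_mulPoint hW C i j (t := 0) (h0 i)
  refine ⟨Matrix.of fun i k => w i k, fun i k => hw i k, funext fun i => ?_⟩
  simp only [Matrix.mulVec, dotProduct, Matrix.of_apply, Pi.zero_apply]
  exact hw0 i

variable [DecidableEq ι]

/-! ## §5 The iteration (1) -/

/-- The braces of (1): `m(𝓦) + 𝓦(𝓘 − 𝓐⁽ᵏ⁾m(𝓦))` for interval matrices `𝓐⁽ᵏ⁾`, `𝓦`.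
[cite: AlefeldHerzberger1983, Ch. 20 (1)] -/
def core (Ak W : IMat ι) : IMat ι := addPoint (mid W) (imul W (pointSub 1 (mulPoint Ak (mid W))))

/-- One step of (1): `(𝓐⁽ᵏ⁾, 𝓦⁽ᵏ⁾) ↦ {m(𝓦⁽ᵏ⁾) + 𝓦⁽ᵏ⁾(𝓘 − 𝓐⁽ᵏ⁾m(𝓦⁽ᵏ⁾))} ∩ 𝓦⁽ᵏ⁾` (bounds `max`/`min`).
[cite: AlefeldHerzberger1983, Ch. 20 (1)] -/
def vstep (Ak W : IMat ι) : IMat ι :=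
  (Matrix.of fun i j => max (W.1 i j) ((core Ak W).1 i j), Matrix.of fun i j => min (W.2 i j) ((core Ak W).2 i j))

/-- The sequence `{𝓦⁽ᵏ⁾}` of (1) from `𝓦⁽⁰⁾` and the sequence `{𝓐⁽ᵏ⁾}`. [cite: AlefeldHerzberger1983, Ch. 20 (1)] -/
def seqW (As : ℕ → IMat ι) (W0 : IMat ι) : ℕ → IMat ι
  | 0 => W0
  | k + 1 => vstep (As k) (seqW As W0 k)

/-- [cite: AlefeldHerzberger1983, Ch. 20 (1)] -/
@[simp] theorem seqW_zero (As : ℕ → IMat ι) (W0 : IMat ι) : seqW As W0 0 = W0 := rfl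

/-- [cite: AlefeldHerzberger1983, Ch. 20 (1)] -/
theorem seqW_succ (As : ℕ → IMat ι) (W0 : IMat ι) (k : ℕ) :
    seqW As W0 (k + 1) = vstep (As k) (seqW As W0 k) := rfl

/-- `𝓟 ∈ 𝓨 ∩ 𝓦 ⇔ 𝓟 ∈ 𝓦 ∧ 𝓟 ∈ 𝓨`. [cite: AlefeldHerzberger1983, Ch. 20 (1)] -/
theorem mem_vstep_iff (Ak W : IMat ι) (P : Matrix ι ι ℝ) :
    Mem P (vstep Ak W) ↔ Mem P W ∧ Mem P (core Ak W) := by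
  simp only [Mem, vstep, Matrix.of_apply, max_le_iff, le_min_iff]
  exact ⟨fun h => ⟨fun i j => ⟨(h i j).1.1, (h i j).2.1⟩, fun i j => ⟨(h i j).1.2, (h i j).2.2⟩⟩,
    fun h i j => ⟨⟨(h.1 i j).1, (h.2 i j).1⟩, (h.1 i j).2, (h.2 i j).2⟩⟩

/-- The iterates of (1) are nested: `𝓦⁽ᵏ⁺¹⁾ ⊆ 𝓦⁽ᵏ⁾`. [cite: AlefeldHerzberger1983, Ch. 20 (1)] -/
theorem vstep_incl (Ak W : IMat ι) : Incl (vstep Ak W) W := fun i j => by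
  simp only [vstep, Matrix.of_apply]
  exact ⟨le_max_left _ _, min_le_left _ _⟩

/-- `𝓦⁽ᵏ⁺¹⁾ ⊆ {m(𝓦⁽ᵏ⁾) + 𝓦⁽ᵏ⁾(𝓘 − 𝓐⁽ᵏ⁾m(𝓦⁽ᵏ⁾))}` bound-wise. [cite: AlefeldHerzberger1983, Ch. 20 (1)] -/
theorem core_fst_le_vstep_fst (Ak W : IMat ι) (i j : ι) : (core Ak W).1 i j ≤ (vstep Ak W).1 i j := by
  simp only [vstep, Matrix.of_apply]
  exact le_max_right _ _

/-- [cite: AlefeldHerzberger1983, Ch. 20 (1)] -/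
theorem vstep_snd_le_core_snd (Ak W : IMat ι) (i j : ι) : (vstep Ak W).2 i j ≤ (core Ak W).2 i j := by
  simp only [vstep, Matrix.of_apply]
  exact min_le_right _ _

/-- [cite: AlefeldHerzberger1983, Ch. 20 (1)] -/
theorem seqW_succ_incl (As : ℕ → IMat ι) (W0 : IMat ι) (k : ℕ) : Incl (seqW As W0 (k + 1)) (seqW As W0 k) := by
  rw [seqW_succ]
  exact vstep_incl _ _

/-- `𝓦⁽ᵏ⁾ ⊆ 𝓦⁽⁰⁾`. [cite: AlefeldHerzberger1983, Ch. 20 (1)] -/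
theorem seqW_incl_zero (As : ℕ → IMat ι) (W0 : IMat ι) : ∀ k, Incl (seqW As W0 k) W0
  | 0 => incl_refl _
  | k + 1 => incl_trans (seqW_succ_incl As W0 k) (seqW_incl_zero As W0 k)

/-- For the constant degenerate sequence `𝓐⁽ᵏ⁾ = 𝓐` the braces of (1) are the map (18.5) with `r = 2`.
[cite: AlefeldHerzberger1983, Ch. 20, remark after Thm 1] -/
theorem core_thin (A : Matrix ι ι ℝ) (W : IMat ι) : core (thin A) W = schulzStep A 2 W := by
  rw [schulzStep_two, core, mulPoint_thin, pointSub_thin, imul_thin]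

/-- "The iteration method (18.9) with `r = 2` is obtained as a special case when `𝓐⁽ᵏ⁾ = 𝓐`": one step.
[cite: AlefeldHerzberger1983, Ch. 20, remark after Thm 1] -/
theorem vstep_thin (A : Matrix ι ι ℝ) (W : IMat ι) : vstep (thin A) W = interStep A 2 W := by
  simp only [vstep, interStep, core_thin]

/-- "The iteration method (18.9) with `r = 2` is obtained as a special case when `𝓐⁽ᵏ⁾ = 𝓐`": the whole
sequence. [cite: AlefeldHerzberger1983, Ch. 20, remark after Thm 1] -/
theorem seqW_thin (A : Matrix ι ι ℝ) (W0 : IMat ι) : ∀ k, seqW (fun _ => thin A) W0 k = (interStep A 2)^[k] W0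
  | 0 => rfl
  | k + 1 => by rw [seqW_succ, seqW_thin A W0 k, vstep_thin, Function.iterate_succ_apply']

/-! ## §6 Theorem 1 (2a): every iterate contains `𝓐⁻¹` -/

/-- `𝓐⁻¹ = m(𝓦) + 𝓐⁻¹(𝓘 − 𝓐m(𝓦)) ∈ m(𝓦) + 𝓦(𝓘 − 𝓐⁽ᵏ⁾m(𝓦))` whenever `𝓐 ∈ 𝓐⁽ᵏ⁾`, `𝓐⁻¹ ∈ 𝓦`.
[cite: AlefeldHerzberger1983, Ch. 20 Thm 1, proof of (a)] -/
theorem inv_mem_core {A : Matrix ι ι ℝ} (hA : IsUnit A.det) {Ak W : IMat ι} (hAk : Mem A Ak) (hW : Mem A⁻¹ W) :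
    Mem A⁻¹ (core Ak W) := by
  have hid : A⁻¹ = mid W + A⁻¹ * (1 - A * mid W) := by
    rw [Matrix.mul_sub, Matrix.mul_one, ← Matrix.mul_assoc, Matrix.nonsing_inv_mul A hA, Matrix.one_mul]
    abel
  rw [hid]
  exact add_mem_addPoint (mul_mem_imul hW (sub_mem_pointSub (mul_mem_mulPoint hAk (mid W)) 1)) (mid W)

/-- **Theorem 1 (2a)**: if `𝓐 ∈ 𝓐⁽ᵏ⁾` for all `k` and `𝓐⁻¹ ∈ 𝓦⁽⁰⁾`, then `𝓐⁻¹ ∈ 𝓦⁽ᵏ⁾` for all `k ≥ 0` (in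
particular no iterate is empty). [cite: AlefeldHerzberger1983, Ch. 20 Thm 1 (2a)] -/
theorem inv_mem_seqW {A : Matrix ι ι ℝ} (hA : IsUnit A.det) {As : ℕ → IMat ι} (hAs : ∀ k, Mem A (As k))
    {W0 : IMat ι} (h0 : Mem A⁻¹ W0) : ∀ k, Mem A⁻¹ (seqW As W0 k)
  | 0 => h0
  | k + 1 => by
    rw [seqW_succ, mem_vstep_iff]
    exact ⟨inv_mem_seqW hA hAs h0 k, inv_mem_core hA (hAs k) (inv_mem_seqW hA hAs h0 k)⟩

/-- Every iterate of (1) is a genuine interval matrix. [cite: AlefeldHerzberger1983, Ch. 20 Thm 1 (2a)] -/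
theorem isProper_seqW {A : Matrix ι ι ℝ} (hA : IsUnit A.det) {As : ℕ → IMat ι} (hAs : ∀ k, Mem A (As k))
    {W0 : IMat ι} (h0 : Mem A⁻¹ W0) (k : ℕ) : IsProper (seqW As W0 k) :=
  isProper_of_mem (inv_mem_seqW hA hAs h0 k)

/-- Remark after Theorem 1: if `𝓐⁽ᵏ⁾ ⊇ 𝓐` for an interval matrix `𝓐` and all `k`, then
`{𝓐̃⁻¹ | 𝓐̃ ∈ 𝓐} ⊆ 𝓦⁽⁰⁾` implies `{𝓐̃⁻¹ | 𝓐̃ ∈ 𝓐} ⊆ 𝓦⁽ᵏ⁾`, `k ≥ 0` (for the nonsingular `𝓐̃ ∈ 𝓐`).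
[cite: AlefeldHerzberger1983, Ch. 20, remark after Thm 1] -/
theorem inv_mem_seqW_of_incl {Al : IMat ι} {As : ℕ → IMat ι} (hAs : ∀ k, Incl Al (As k)) {W0 : IMat ι}
    (h0 : ∀ P : Matrix ι ι ℝ, Mem P Al → IsUnit P.det → Mem P⁻¹ W0) {P : Matrix ι ι ℝ} (hP : Mem P Al)
    (hPdet : IsUnit P.det) (k : ℕ) : Mem P⁻¹ (seqW As W0 k) :=
  inv_mem_seqW hPdet (fun k => mem_of_mem_of_incl hP (hAs k)) (h0 P hP hPdet) k

/-! ## §7 Continuity of the iteration (1) -/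

/-- [folklore] continuity of the lower interval-product bound in its four arguments. -/
private theorem continuous_pmulLo' {α : Type*} [TopologicalSpace α] {f₁ f₂ g₁ g₂ : α → ℝ}
    (h₁ : Continuous f₁) (h₂ : Continuous f₂) (h₃ : Continuous g₁) (h₄ : Continuous g₂) :
    Continuous fun p => pmulLo (f₁ p) (f₂ p) (g₁ p) (g₂ p) := by
  simp only [pmulLo]
  exact ((h₁.mul h₃).min (h₁.mul h₄)).min ((h₂.mul h₃).min (h₂.mul h₄))

/-- [folklore] continuity of the upper interval-product bound in its four arguments. -/
private theorem continuous_pmulHi' {α : Type*} [TopologicalSpace α] {f₁ f₂ g₁ g₂ : α → ℝ}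
    (h₁ : Continuous f₁) (h₂ : Continuous f₂) (h₃ : Continuous g₁) (h₄ : Continuous g₂) :
    Continuous fun p => pmulHi (f₁ p) (f₂ p) (g₁ p) (g₂ p) := by
  simp only [pmulHi]
  exact ((h₁.mul h₃).max (h₁.mul h₄)).max ((h₂.mul h₃).max (h₂.mul h₄))

/-- "From the continuity of the iteration (1)": the braces of (1) depend continuously on the pair
`(𝓐⁽ᵏ⁾, 𝓦⁽ᵏ⁾)`. [cite: AlefeldHerzberger1983, Ch. 20 Thm 1, proof of (b)] -/
theorem continuous_core : Continuous fun p : IMat ι × IMat ι => core p.1 p.2 := by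
  have hA1 : ∀ i j, Continuous fun p : IMat ι × IMat ι => p.1.1 i j := fun i j =>
    (continuous_fst.comp continuous_fst).matrix_elem i j
  have hA2 : ∀ i j, Continuous fun p : IMat ι × IMat ι => p.1.2 i j := fun i j =>
    (continuous_snd.comp continuous_fst).matrix_elem i j
  have hW1 : ∀ i j, Continuous fun p : IMat ι × IMat ι => p.2.1 i j := fun i j =>
    (continuous_fst.comp continuous_snd).matrix_elem i j
  have hW2 : ∀ i j, Continuous fun p : IMat ι × IMat ι => p.2.2 i j := fun i j =>
    (continuous_snd.comp continuous_snd).matrix_elem i j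
  have hmid : Continuous fun p : IMat ι × IMat ι => mid p.2 :=
    continuous_matrix fun i j => ((hW1 i j).add (hW2 i j)).div_const _
  have hM1 : Continuous fun p : IMat ι × IMat ι => (mulPoint p.1 (mid p.2)).1 :=
    continuous_matrix fun i j => continuous_finsetSum _ fun k _ =>
      ((hA1 i k).mul (hmid.matrix_elem k j)).min ((hA2 i k).mul (hmid.matrix_elem k j))
  have hM2 : Continuous fun p : IMat ι × IMat ι => (mulPoint p.1 (mid p.2)).2 :=
    continuous_matrix fun i j => continuous_finsetSum _ fun k _ =>
      ((hA1 i k).mul (hmid.matrix_elem k j)).max ((hA2 i k).mul (hmid.matrix_elem k j))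
  have hT1 : Continuous fun p : IMat ι × IMat ι => (pointSub 1 (mulPoint p.1 (mid p.2))).1 :=
    continuous_const.sub hM2
  have hT2 : Continuous fun p : IMat ι × IMat ι => (pointSub 1 (mulPoint p.1 (mid p.2))).2 :=
    continuous_const.sub hM1
  have hI1 : Continuous fun p : IMat ι × IMat ι => (imul p.2 (pointSub 1 (mulPoint p.1 (mid p.2)))).1 :=
    continuous_matrix fun i j => by
      simp only [imul_fst_apply]
      exact continuous_finsetSum _ fun k _ =>
        continuous_pmulLo' (hW1 i k) (hW2 i k) (hT1.matrix_elem k j) (hT2.matrix_elem k j)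
  have hI2 : Continuous fun p : IMat ι × IMat ι => (imul p.2 (pointSub 1 (mulPoint p.1 (mid p.2)))).2 :=
    continuous_matrix fun i j => by
      simp only [imul_snd_apply]
      exact continuous_finsetSum _ fun k _ =>
        continuous_pmulHi' (hW1 i k) (hW2 i k) (hT1.matrix_elem k j) (hT2.matrix_elem k j)
  exact (hmid.add hI1).prodMk (hmid.add hI2)

/-! ## §8 Theorem 1 (2b): convergence to `𝓐⁻¹` -/

/-- **Theorem 1 (2b)**: let `𝓐` be nonsingular, `𝓐 ∈ 𝓐⁽ᵏ⁾` for all `k`, `lim 𝓐⁽ᵏ⁾ = 𝓐`, `𝓐⁻¹ ∈ 𝓦⁽⁰⁾`, and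
let every matrix `𝓦 ∈ 𝓦⁽⁰⁾` be nonsingular.  Then the iterates (1) satisfy `lim 𝓦⁽ᵏ⁾ = 𝓐⁻¹`.
[cite: AlefeldHerzberger1983, Ch. 20 Thm 1 (2b)] -/
theorem thm20_1 {A : Matrix ι ι ℝ} (hA : IsUnit A.det) {As : ℕ → IMat ι} (hAs : ∀ k, Mem A (As k))
    (hlimA : TendstoI As A) {W0 : IMat ι} (h0 : Mem A⁻¹ W0)
    (hreg : ∀ P : Matrix ι ι ℝ, Mem P W0 → IsUnit P.det) : TendstoI (seqW As W0) A⁻¹ := by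
  have hmem : ∀ k, Mem A⁻¹ (seqW As W0 k) := inv_mem_seqW hA hAs h0
  have hprop : ∀ k, IsProper (seqW As W0 k) := fun k => isProper_of_mem (hmem k)
  -- Cor. 10.8: the nested iterates converge to an interval matrix `L ⊆ 𝓦⁽⁰⁾` containing `𝓐⁻¹`
  obtain ⟨L, hL, hLp, hLk, hLmax⟩ := cor10_8 (seqW_succ_incl As W0) hprop
  have hLW0 : Incl L W0 := hLk 0
  have hAL : Mem A⁻¹ L :=
    (mem_iff_incl_thin _ _).2 (hLmax (thin A⁻¹) (isProper_thin _) fun k => (mem_iff_incl_thin _ _).1 (hmem k))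
  have hmidL : Mem (mid L) L := mid_mem hLp
  -- continuity of (1): `core (𝓐⁽ᵏ⁾, 𝓦⁽ᵏ⁾) → core ([𝓐, 𝓐], L)`
  have hpair : Tendsto (fun k => (As k, seqW As W0 k)) atTop (𝓝 (thin A, L)) :=
    ((limI_iff_tendsto _ _).1 ((tendstoI_iff_limI_thin _ _).1 hlimA)).prodMk_nhds ((limI_iff_tendsto _ _).1 hL)
  have hcore := (continuous_core.tendsto (thin A, L)).comp hpair
  have hc : LimI (fun k => core (As k) (seqW As W0 k)) (core (thin A) L) := (limI_iff_tendsto _ _).2 hcore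
  -- `L ⊆ core ([𝓐, 𝓐], L)`: pass to the limit in `𝓦⁽ᵏ⁺¹⁾ ⊆ core (𝓐⁽ᵏ⁾, 𝓦⁽ᵏ⁾)`
  have hsub1 : ∀ i j, (core (thin A) L).1 i j ≤ L.1 i j := fun i j =>
    le_of_tendsto_of_tendsto' (hc i j).1 ((hL i j).1.comp (tendsto_add_atTop_nat 1)) fun k => by
      show (core (As k) (seqW As W0 k)).1 i j ≤ (seqW As W0 (k + 1)).1 i j
      rw [seqW_succ]
      exact core_fst_le_vstep_fst _ _ i j
  have hsub2 : ∀ i j, L.2 i j ≤ (core (thin A) L).2 i j := fun i j =>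
    le_of_tendsto_of_tendsto' ((hL i j).2.comp (tendsto_add_atTop_nat 1)) (hc i j).2 fun k => by
      show (seqW As W0 (k + 1)).2 i j ≤ (core (As k) (seqW As W0 k)).2 i j
      rw [seqW_succ]
      exact vstep_snd_le_core_snd _ _ i j
  rw [core_thin, schulzStep_two] at hsub1 hsub2
  -- `m(L) ∈ L ⊆ m(L) + L(𝓘 − 𝓐m(L))`, so `𝓞 ∈ L(𝓘 − 𝓐m(L))`
  have hzero : ∀ i j, (mulPoint L (1 - A * mid L)).1 i j ≤ 0 ∧ 0 ≤ (mulPoint L (1 - A * mid L)).2 i j := by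
    intro i j
    have h1 := (hsub1 i j).trans (hmidL i j).1
    have h2 := (hmidL i j).2.trans (hsub2 i j)
    simp only [addPoint_fst, addPoint_snd, Matrix.add_apply] at h1 h2
    constructor <;> linarith
  -- (10.1) column by column: `𝓘 − 𝓐m(L) = 𝓞`
  have hC : 1 - A * mid L = 0 := by
    ext i j
    obtain ⟨P, hPL, hP0⟩ := exists_mem_mulVec_col_eq_zero hLp (1 - A * mid L) j fun i' => hzero i' j
    have hdet : IsUnit P.det := hreg P (mem_of_mem_of_incl hPL hLW0)
    have hcol := Matrix.eq_zero_of_mulVec_eq_zero hdet.ne_zero hP0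
    exact congrFun hcol i
  -- hence `m(L) = 𝓐⁻¹` and `L = [𝓐⁻¹, 𝓐⁻¹]`
  have hmid : A⁻¹ = mid L := Matrix.inv_eq_right_inv (sub_eq_zero.1 hC).symm
  rw [hC, mulPoint_zero] at hsub1 hsub2
  intro i j
  have h1 : mid L i j ≤ L.1 i j := by simpa [addPoint_fst, Matrix.add_apply] using hsub1 i j
  have h2 : L.2 i j ≤ mid L i j := by simpa [addPoint_snd, Matrix.add_apply] using hsub2 i j
  have hL1 : L.1 i j = A⁻¹ i j := by rw [hmid]; exact le_antisymm (hmidL i j).1 h1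
  have hL2 : L.2 i j = A⁻¹ i j := by rw [hmid]; exact le_antisymm h2 (hmidL i j).2
  refine ⟨?_, ?_⟩
  · rw [← hL1]; exact (hL i j).1
  · rw [← hL2]; exact (hL i j).2

/-- Theorem 1 (2b) for the special case `𝓐⁽ᵏ⁾ = 𝓐`: the method (18.9) with `r = 2` converges to `𝓐⁻¹`
whenever `𝓐⁻¹ ∈ 𝓧⁽⁰⁾` and every `𝓧 ∈ 𝓧⁽⁰⁾` is nonsingular. [cite: AlefeldHerzberger1983, Ch. 20 Thm 1 (2b), remark] -/
theorem thm20_1_const {A : Matrix ι ι ℝ} (hA : IsUnit A.det) {X0 : IMat ι} (h0 : Mem A⁻¹ X0)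
    (hreg : ∀ P : Matrix ι ι ℝ, Mem P X0 → IsUnit P.det) : TendstoI (fun k => (interStep A 2)^[k] X0) A⁻¹ := by
  have h := thm20_1 hA (As := fun _ => thin A) (fun _ => mem_thin A)
    (fun i j => ⟨tendsto_const_nhds, tendsto_const_nhds⟩) h0 hreg
  intro i j
  simpa only [seqW_thin] using h i j

end Literature.Analysis.ValidatedNumerics.InverseInclusionIteration

end
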